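/-
Copyright (c) 2026 the pub-hodgecm-mathlib formalisation cell (harness21).  Prover seat hodgecm-mathlib-K2E3-p29 (g2): Track B «K2-LIT», hLiu418 = stmt-HodgeConjecture-24832;
socket #41, KIND W, (iii-fin) row (KW-fin-ball) — KW desk K2E3-p11 (g10) deal 2026-09-05T01:14:30Z, cc LEAD F0P6-plan (g15).  THEOREMS ONLY (no `def`, no `instance`,
no notation, no named-fact hypothesis, no `sorry`).
-/
import Summits.HodgeConjecture.HodgeConjecture.Theorems.K2LiuKindWFactorLevelInvariance   -- ★ p863964 (K2E3-p26): `FvT_mul_mul_evalPlace_eq` (LEVEL currency), `congruenceGL`, `GLn.localHeight`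
import Summits.HodgeConjecture.HodgeConjecture.Theorems.K2LiuKindWFiniteLetterDefs        -- ★ p863154 (this seat): `kindWLocalBall`, `mem_kindWLocalBall_iff`
import Summits.HodgeConjecture.HodgeConjecture.Theorems.K2LiuUnipotentDeepLevel           -- ★ (lat-a) ED. 2 `nElem_apply_mem_congruenceGL_pow_of_two` (every place, dyadic included)
import Summits.HodgeConjecture.HodgeConjecture.Theorems.K2LiuUnipDeltaLocalCoordinates    -- ★ `eq_nElem_of_mem_unipDeltaLocal` (`u = n(B(matA u))`)
import Summits.HodgeConjecture.HodgeConjecture.Theorems.K2LiuUnipDeltaLocBridge           -- ★ B1 `mem_unipDeltaLoc_iff_mem_unipDeltaLocal`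
import Literature.NumberTheory.Automorphic.ValuedFieldValuativeRelBridge                   -- ★ `v_le_iff_valuation_le` (`Valued.v` ↔ `ValuativeRel.valuation`)
import HarnessLib

/-!
# Crux `HLiu418`, socket #41, KIND W — `K2LiuKindWFactorLevelInvarianceBall` ((KW-fin-ball)): THE LEVEL-INVARIANCE LETTER `hFinv` OF ★ p863728 IN BALL CURRENCY —
# «`u₀ ∈ kindWLocalBall v (π v) (a₀ h v)` ⟹ `FvT j S h v s (W_v·(y u₀)·h_v) = FvT j S h v s (W_v·y·h_v)`», the last mile BALL ⇒ LEVEL over ★ p863964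

Cell `hodgecm-mathlib`, crux item hLiu418 = `stmt-HodgeConjecture-24832` (helper lane `--supports … --as helper`, count-neutral), route of record `HCCMUnconditional`; squad K2 ∕
K2Liu, road `K2_Liu`, socket #41 `sig_K2LiuSiegelEisensteinContinuation`, KIND W, (iii-fin) row; KW desk K2E3-p11 (g10) deal 01:14:30Z (K2E3-p26 (g3) released it 01:07:03Z).
THE POINT.  ★ p863728 `K2LiuKindWFiniteSupportLetterOfLevel.hsuppLoc_of_level` (K2E3-p03) takes the LEVEL letter BY VALUE, in BALL currency:
`hFinv : ∀ j S h v hv s (y u₀ : N_Δ(L⁺_v)), u₀ ∈ kindWLocalBall v (π v) (a₀ h v) → FvT j S h ⟨v,hv⟩ s (W_v·↑(y u₀)·h_v) = FvT j S h ⟨v,hv⟩ s (W_v·↑y·h_v)` (`W_v = evalPlace v (finPart w_Δ)`,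
`h_v = evalPlace v (finPart h)`, the exponent function `a₀ : H(𝔸) → 𝔭 → ℤ` FREE).  ★ p863964 `K2LiuKindWFactorLevelInvariance.FvT_mul_mul_evalPlace_eq` (K2E3-p26) proves its body in
LEVEL currency: `FvT(y·k·h_v) = FvT(y·h_v)` for `k_w ∈ K_w(ϖ_w^{c_w + 2a_w}) = congruenceGL (n+n) (valuation ϖ_w ^ (c_w + 2a_w))` at every `w ∣ v`, from the principal level `c` of the
factors (`hlev`, = ★ `exists_levels_forall_FvT_mul_eq`'s conclusion) and the local heights `H_w(h) ≤ q_w^{a_w}` of `h`.  THIS FILE is the last mile «BALL ⇒ LEVEL»: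
* §1 **`coe_apply_mem_congruenceGL_of_mem_kindWLocalBall`** — for `u₀ ∈ N_Δ(L⁺_v)` in the ball of exponent `a₀` (`|B(u₀)_{ij}|_w ≤ |π_v|_w^{a₀}`, `π_v` a uniformiser of `L⁺_v`)
  and a DEPTH inequality `|π_v|_w^{a₀} ≤ |2|_w·|ϖ_w|^M` at `w ∣ v`: `(u₀)_w ∈ congruenceGL (n+n) (valuation ϖ_w ^ M)` — `u₀ = n(B(u₀))` (★ `eq_nElem_of_mem_unipDeltaLocal` through ★ B1), then
  ★ (lat-a) ED. 2 `nElem_apply_mem_congruenceGL_pow_of_two` (EVERY place, the dyadic factor `|2|_w` carried in the depth inequality; valuations bridged by ★ `v_le_iff_valuation_le`);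
  `exists_two_defect` — at each `v` an exponent `d` with `|π_v|_w^d ≤ |2|_w` for all `w ∣ v` (★ Φ5-data `exists_two_threshold`; `d = 0` off the dyadic places).
* §2 HEAD **`hFinv_of_levels`** — ★ p863728's `hFinv` binder bytes VERBATIM (∀-closed over `j S h v hv s y u₀`), from BY-VALUE letters: uniformisers `π` of `L⁺` (`hπ`) and `ϖ` of `L`
  (`hϖ`), the principal level `c` with `hlev` (★ p863964's conclusion bytes), height exponents `a : H(𝔸) → (places of L) → ℕ` with `ha : H_w(x) ≤ q_w^{a x w}` (★ (c1)
  `exists_localHeight_eq_pow`), and ANY exponent function `a₀` satisfying the DEPTH letter `ha₀ : |π_v|_w^{a₀ h v} ≤ |2|_w·|ϖ_w|^{c_w + 2·a h w}` (`w ∣ v`) — §1 + ★ `FvT_mul_mul_evalPlace_eq`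
  at `y := W_v·y`, `k := u₀`, `x := h` (`↑(y u₀) = ↑y·↑u₀`, `mul_assoc`).
* §3 **`hFinv_of_levels_sum`** — the same at the EXPLICIT choice `a₀ h v := d v + Σ_{w∣v} (c w + 2·a h w)` (∈ ℕ ⊂ ℤ; `d` any two-defect exponent, letter `hd`, §1 `exists_two_defect`):
  the depth letter discharged (`|π_v|_w ≤ |ϖ_w| ≤ 1`, ★ `valued_toPlace_uniformizer_le`), so the (KW-fin-OF-RECORD) package `obtain`s `hFinv` by name with `(Tc, c)` from ★
  `exists_levels_forall_FvT_mul_eq`, `a` from the height letters and `d` from `exists_two_defect`.  SIGN: in ★ p863154's `kindWLocalBall v π a` a LARGER `a` is a DEEPER (smaller)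
  ball, so `a₀ ≥ 0` here.
[Casselman1980, §3], [PlatonovRapinchuk1994, §5.1], [HarishChandra1999, §17], [BorelJacquet1979, §4.1], [HarrisKudlaSweet1996, §1 (1.11)].
HONEST LABEL.  Count-neutral helper, closes no socket: `HC_CM` is proved only modulo the 7 printed citations (2 remaining named inputs: hLiu418 = `stmt-HodgeConjecture-24832`, h413 =
`stmt-HodgeConjecture-24833`) until rung 0 closes.  NOT HERE (by value): the level letter `hlev` (★ p863964 `exists_levels_forall_FvT_mul_eq` for the (KW-fac) reading), the height
exponents `a` (★ (c1)), the dual-lattice companion `hdual` on the same ball (F0P2-p09 ★ p863721 ∕ p863825).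

## References
* [Casselman1980] W. Casselman, *The unramified principal series of p-adic groups I*, Compositio Math. 40 (1980): §3 (deep unipotents act trivially on vectors of deep level).
* [PlatonovRapinchuk1994] V. Platonov, A. Rapinchuk, *Algebraic Groups and Number Theory* (1994): §5.1 (principal congruence subgroups).
* [HarishChandra1999] Harish-Chandra (DeBacker–Sally, eds.), *Admissible invariant distributions on reductive p-adic groups*, ULS 16 (1999): §17 (conjugating levels by bounded elements).
* [BorelJacquet1979] A. Borel, H. Jacquet, Proc. Sympos. Pure Math. 33.1 (1979): §4.1 (levels of smooth vectors).
* [HarrisKudlaSweet1996] M. Harris, S. Kudla, W. J. Sweet, J. AMS 9 (1996): §1 (1.11) (`N_Δ ≅ Herm_n`, `n(t)`).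
-/

set_option autoImplicit false
-- the mandated namespace repeats the single-problem summit's segment (`HodgeConjecture.HodgeConjecture`)
set_option linter.dupNamespace false

noncomputable section

open scoped Matrix NNReal MatrixGroups WithZero Topology BigOperators
open NumberField IsDedekindDomain Matrix ValuativeRel
open Literature.NumberTheory.Automorphic hiding IsKFinite
open Literature.NumberTheory.Automorphic.UnitaryGroup Literature.NumberTheory.GaloisRepresentations
open Literature.NumberTheory.GelbartRogawski1991 Literature.NumberTheory.GelbartRogawski1991.GRConstruction
open Literature.NumberTheory.GelbartRogawski1991.AdaptedBlocks
open Literature.NumberTheory.GelbartRogawski1991.UnitaryDualPair Literature.NumberTheory.GelbartRogawski1991.UnitaryDualPair.LocalSplitting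
open Literature.NumberTheory.K2Lit.SiegelDoubled Literature.NumberTheory.K2Lit.LocalSiegelDoubled Literature.NumberTheory.K2Lit.PlaceSplitting
open Summit.HodgeConjecture.HodgeConjecture.Cruxes.HLiu418.K2LiuSiegelUnipotentLocalDefs
open Summit.HodgeConjecture.HodgeConjecture.Cruxes.HLiu418.K2LiuSiegelUnipotentFourierDefs (skewMatrices)
open Summit.HodgeConjecture.HodgeConjecture.Cruxes.HLiu418.K2LiuSiegelEisensteinKindWLetters (kindWFinset)
open Summit.HodgeConjecture.HodgeConjecture.Cruxes.HLiu418.K2LiuKindWFiniteLetterDefs (kindWLocalBall mem_kindWLocalBall_iff)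
open Summit.HodgeConjecture.HodgeConjecture.Cruxes.HLiu418.K2LiuKindWFactorLevelInvariance (FvT_mul_mul_evalPlace_eq)
open Summit.HodgeConjecture.HodgeConjecture.Cruxes.HLiu418.K2LiuUnipotentDeepLevel (nElem_apply_mem_congruenceGL_pow_of_two)
open Summit.HodgeConjecture.HodgeConjecture.Cruxes.HLiu418.K2LiuUnipDeltaLocalCoordinates (eq_nElem_of_mem_unipDeltaLocal)
open Summit.HodgeConjecture.HodgeConjecture.Cruxes.HLiu418.K2LiuUnipDeltaLocBridge (mem_unipDeltaLoc_iff_mem_unipDeltaLocal)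
open Summit.HodgeConjecture.HodgeConjecture.Cruxes.HLiu418.K2LiuLocalRingValuationBalls
  (valued_toPlace_uniformizer_le valued_toPlace_uniformizer_ne_zero valued_toPlace_uniformizer_le_one)
open Summit.HodgeConjecture.HodgeConjecture.Cruxes.HLiu418.K2LiuBadPlaceWhittakerData (exists_two_threshold)

namespace Summit.HodgeConjecture.HodgeConjecture.Cruxes.HLiu418.K2LiuKindWFactorLevelInvarianceBall

variable (L : Type) [Field L] [NumberField L] [IsCMField L]
variable {N M n : ℕ} (e : Fin N × Fin M ≃ Fin n)
  (dV : Fin N → L) (hdV : ∀ i, IsCMField.complexConj L (dV i) = dV i)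
  (dW : Fin M → L) (hdW : ∀ i, IsCMField.complexConj L (dW i) = dW i)
  (v : HeightOneSpectrum (𝓞 (Fp L)))

/-! ## §1 BALL ⇒ LEVEL at one place: a deep unipotent of `N_Δ(L⁺_v)` lies in a deep principal level at every `w ∣ v` -/

/-- **BALL ⇒ LEVEL.**  For `u₀ ∈ N_Δ(L⁺_v)` in ★ p863154's ball of exponent `a₀` for the uniformiser `π` of `L⁺_v` (`|B(u₀)_{ij}|_w ≤ |π|_w^{a₀}` at every `w ∣ v`), a place `w ∣ v`, an
element `ϖ` of `L_w` of valuation `exp(−1)` and `M : ℕ` with the DEPTH inequality `|π|_w^{a₀} ≤ |2|_w · |ϖ|^M`:  the `w`-component of `u₀` lies in `congruenceGL (n+n) (valuation ϖ ^ M)`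
(`u₀ = n(B(u₀))`, ★ `eq_nElem_of_mem_unipDeltaLocal`; ★ (lat-a) ED. 2 `nElem_apply_mem_congruenceGL_pow_of_two` at every place, dyadic included; `Valued.v` ↔ `valuation` by ★
`v_le_iff_valuation_le`). [cite: Casselman1980, §3] [cite: PlatonovRapinchuk1994, §5.1] [cite: HarrisKudlaSweet1996, §1 (1.11)] -/
theorem coe_apply_mem_congruenceGL_of_mem_kindWLocalBall {π : v.adicCompletion (Fp L)} (u₀ : ↥(unipDeltaLoc L e dV hdV dW hdW v)) {a₀ : ℤ}
    (hu₀ : u₀ ∈ kindWLocalBall L e dV hdV dW hdW v π a₀) (w : UnitaryGroup.PlacesOver L v) {ϖ : w.1.adicCompletion L}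
    (hϖ : Valued.v ϖ = WithZero.exp (-1 : ℤ)) (M : ℕ)
    (hdepth : Valued.v (UnitaryGroup.toPlace v w π) ^ a₀ ≤ Valued.v (2 : w.1.adicCompletion L) * Valued.v ϖ ^ M) :
    (((u₀ : ↥(unipDeltaLoc L e dV hdV dW hdW v)) : UnitaryGroup.localPi L (IsCMField.complexConj L) (n + n) (hermD L e dV hdV dW hdW) v) :
        UnitaryGroup.LocalGLPi L (n + n) v) w ∈ congruenceGL (n + n) (valuation (w.1.adicCompletion L) ϖ ^ M) := by
  haveI : Algebra.IsQuadraticExtension (Fp L) L := IsCMField.isQuadraticExtension L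
  have hu := (mem_unipDeltaLoc_iff_mem_unipDeltaLocal L e dV hdV dW hdW v _).1 u₀.2
  have heq := eq_nElem_of_mem_unipDeltaLocal (Fp L) L (IsCMField.complexConj L) v n (hermD_eq_map_gramD L e dV hdV dW hdW) hu
  rw [heq]
  refine nElem_apply_mem_congruenceGL_pow_of_two (Fp L) L (IsCMField.complexConj L) v n (hermD_eq_map_gramD L e dV hdV dW hdW) _ ?_ M fun i j => ?_
  · -- `valuation ϖ ≤ 1`
    rw [← map_one (valuation (w.1.adicCompletion L)), ← v_le_iff_valuation_le, map_one, hϖ, ← WithZero.exp_zero, WithZero.exp_le_exp]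
    norm_num
  · -- the entries of `B(u₀)` at `w`
    have hij := (mem_kindWLocalBall_iff L e dV hdV dW hdW v π a₀ u₀).1 hu₀ i j w
    have h2 : Valued.v (blkB (matA (Fp L) L (IsCMField.complexConj L) v n
        ((u₀ : ↥(unipDeltaLoc L e dV hdV dW hdW v)) : UnitaryGroup.localPi L (IsCMField.complexConj L) (n + n) (hermD L e dV hdV dW hdW) v)) i j w) ≤
        Valued.v ((2 : w.1.adicCompletion L) * ϖ ^ M) := by
      rw [map_mul, map_pow]
      exact hij.trans hdepth
    have h3 := (v_le_iff_valuation_le _ _).1 h2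
    rwa [map_mul, map_pow] at h3

omit [IsCMField L] in
/-- **A TWO-DEFECT EXPONENT EXISTS AT EVERY PLACE**: `∃ d : ℕ, ∀ w ∣ v, |π|_w^d ≤ |2|_w` (★ Φ5-data `exists_two_threshold` gives an integer exponent; `|π|_w ≤ 1` lets one pass to its
positive part; `d = 0` works off the dyadic places). [cite: PlatonovRapinchuk1994, §5.1] -/
theorem exists_two_defect {π : v.adicCompletion (Fp L)} (hπ : Valued.v π = WithZero.exp (-1 : ℤ)) :
    ∃ d : ℕ, ∀ w : UnitaryGroup.PlacesOver L v, Valued.v (UnitaryGroup.toPlace v w π) ^ d ≤ Valued.v (2 : w.1.adicCompletion L) := by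
  obtain ⟨c₂, hc₂⟩ := exists_two_threshold (Fp L) L v hπ
  refine ⟨c₂.toNat, fun w => ?_⟩
  have h := hc₂ w
  rw [Pi.ofNat_apply] at h
  refine le_trans ?_ h
  rw [← zpow_natCast]
  exact zpow_le_zpow_right_of_le_one₀ (zero_lt_iff.2 (valued_toPlace_uniformizer_ne_zero (Fp L) L v hπ w)) (valued_toPlace_uniformizer_le_one (Fp L) L v hπ w)
    (Int.self_le_toNat c₂)

/-! ## §2 HEAD: ★ p863728's `hFinv` binder VERBATIM, from the level letter, the height exponents and a depth letter on `a₀` -/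

set_option maxHeartbeats 800000 in -- MEASURED (as ★ p863728 §5, whose two dependent `FvT` letter blocks this statement repeats): 200 000 and 400 000 fail at `whnf` in the statement, 800 000 passes
/-- **THE LEVEL-INVARIANCE LETTER `hFinv` OF ★ p863728 `hsuppLoc_of_level`, IN BALL CURRENCY, FROM LEVELS.**  BY VALUE: uniformisers `π v` of the places of `L⁺` (`hπ`) and `ϖ w` of the
places of `L` (`hϖ`); the principal level `c` of the local factors `FvT` with its letter `hlev` (★ p863964 `exists_levels_forall_FvT_mul_eq`'s conclusion bytes: `k_w ∈ K_w(ϖ_w^{c_w})` for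
all `w ∣ v` ⟹ `FvT(y·k) = FvT(y)`); height exponents `a : H(𝔸) → (places of L) → ℕ` with `ha : H_w(x) ≤ q_w^{a x w}` (★ (c1) `exists_localHeight_eq_pow`); and an exponent function
`a₀ : H(𝔸) → 𝔭 → ℤ` with the DEPTH letter `ha₀ : |π_v|_w^{a₀ h v} ≤ |2|_w · |ϖ_w|^{c_w + 2·a h w}` at every `w ∣ v`.  THEN, for all `j S h v (hv : v ∈ kindWFinset T₀ S h) s` and
`y u₀ ∈ N_Δ(L⁺_v)` with `u₀ ∈ kindWLocalBall v (π v) (a₀ h v)`:  `FvT j S h ⟨v,hv⟩ s (W_v · ↑(y u₀) · h_v) = FvT j S h ⟨v,hv⟩ s (W_v · ↑y · h_v)` — §1 puts `(u₀)_w` in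
`K_w(ϖ_w^{c_w + 2·a h w})`, and ★ `FvT_mul_mul_evalPlace_eq` (at `y := W_v·↑y`, `k := ↑u₀`, `x := h`) is the body (`↑(y u₀) = ↑y·↑u₀`).
[cite: Casselman1980, §3] [cite: HarishChandra1999, §17] [cite: BorelJacquet1979, §4.1] [cite: PlatonovRapinchuk1994, §5.1] -/
theorem hFinv_of_levels (T₀ : Finset (HeightOneSpectrum (𝓞 (Fp L))))
    {π : ∀ v : HeightOneSpectrum (𝓞 (Fp L)), v.adicCompletion (Fp L)} {m : ℕ}
    (FvT : Fin m → ∀ (S : skewMatrices ((IsCMField.complexConj L : L ≃ₐ[Fp L] L) : L →+* L) ((gramR L e dV hdV dW hdW).map (algebraMap (Fp L) L)))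
      (h : HA L e dV hdV dW hdW) (v : (kindWFinset L e dV hdV dW hdW T₀ (S : Matrix (Fin n) (Fin n) L) h)),
      ℂ → UnitaryGroup.localPi L (IsCMField.complexConj L) (n + n) (hermD L e dV hdV dW hdW) v.1 → ℂ)
    (ϖ : (w : HeightOneSpectrum (𝓞 L)) → w.adicCompletion L) (hϖ : ∀ w, Valued.v (ϖ w) = WithZero.exp (-1 : ℤ)) (c : HeightOneSpectrum (𝓞 L) → ℕ)
    (hlev : ∀ (j : Fin m) (S : skewMatrices ((IsCMField.complexConj L : L ≃ₐ[Fp L] L) : L →+* L) ((gramR L e dV hdV dW hdW).map (algebraMap (Fp L) L)))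
        (h : HA L e dV hdV dW hdW) (v : (kindWFinset L e dV hdV dW hdW T₀ (S : Matrix (Fin n) (Fin n) L) h)) (s : ℂ)
        (y k : UnitaryGroup.localPi L (IsCMField.complexConj L) (n + n) (hermD L e dV hdV dW hdW) v.1),
        (∀ w : UnitaryGroup.PlacesOver L v.1,
          (k : UnitaryGroup.LocalGLPi L (n + n) v.1) w ∈ congruenceGL (n + n) (valuation (w.1.adicCompletion L) (ϖ w.1) ^ c w.1)) →
        FvT j S h v s (y * k) = FvT j S h v s y)
    (a : HA L e dV hdV dW hdW → HeightOneSpectrum (𝓞 L) → ℕ)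
    (ha : ∀ (x : HA L e dV hdV dW hdW) (w : HeightOneSpectrum (𝓞 L)),
      GLn.localHeight (n + n) L w (UnitaryGroup.adelicVal (Fp L) L (IsCMField.complexConj L) (n + n) (hermD L e dV hdV dW hdW) x) ≤
        ((Ideal.absNorm w.asIdeal : ℕ) : ℝ≥0) ^ a x w)
    (a₀ : HA L e dV hdV dW hdW → HeightOneSpectrum (𝓞 (Fp L)) → ℤ)
    (ha₀ : ∀ (x : HA L e dV hdV dW hdW) (v : HeightOneSpectrum (𝓞 (Fp L))) (w : UnitaryGroup.PlacesOver L v),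
      Valued.v (UnitaryGroup.toPlace v w (π v)) ^ a₀ x v ≤ Valued.v (2 : w.1.adicCompletion L) * Valued.v (ϖ w.1) ^ (c w.1 + 2 * a x w.1)) :
    ∀ (j : Fin m) (S : skewMatrices ((IsCMField.complexConj L : L ≃ₐ[Fp L] L) : L →+* L) ((gramR L e dV hdV dW hdW).map (algebraMap (Fp L) L)))
      (h : HA L e dV hdV dW hdW) (v : HeightOneSpectrum (𝓞 (Fp L))) (hv : v ∈ kindWFinset L e dV hdV dW hdW T₀ (S : Matrix (Fin n) (Fin n) L) h) (s : ℂ)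
      (y u₀ : ↥(unipDeltaLoc L e dV hdV dW hdW v)), u₀ ∈ kindWLocalBall L e dV hdV dW hdW v (π v) (a₀ h v) →
      FvT j S h ⟨v, hv⟩ s (UnitaryGroup.evalPlace (Fp L) L (IsCMField.complexConj L) (n + n) (hermD L e dV hdV dW hdW) v
                (UnitaryGroup.finPart (Fp L) L (IsCMField.complexConj L) (n + n) (hermD L e dV hdV dW hdW) (weylDelta L e dV hdV dW hdW)) *
              ((y * u₀ : ↥(unipDeltaLoc L e dV hdV dW hdW v)) : UnitaryGroup.localPi L (IsCMField.complexConj L) (n + n) (hermD L e dV hdV dW hdW) v) *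
              UnitaryGroup.evalPlace (Fp L) L (IsCMField.complexConj L) (n + n) (hermD L e dV hdV dW hdW) v
                (UnitaryGroup.finPart (Fp L) L (IsCMField.complexConj L) (n + n) (hermD L e dV hdV dW hdW) h)) =
      FvT j S h ⟨v, hv⟩ s (UnitaryGroup.evalPlace (Fp L) L (IsCMField.complexConj L) (n + n) (hermD L e dV hdV dW hdW) v
                (UnitaryGroup.finPart (Fp L) L (IsCMField.complexConj L) (n + n) (hermD L e dV hdV dW hdW) (weylDelta L e dV hdV dW hdW)) *
              ((y : ↥(unipDeltaLoc L e dV hdV dW hdW v)) : UnitaryGroup.localPi L (IsCMField.complexConj L) (n + n) (hermD L e dV hdV dW hdW) v) *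
              UnitaryGroup.evalPlace (Fp L) L (IsCMField.complexConj L) (n + n) (hermD L e dV hdV dW hdW) v
                (UnitaryGroup.finPart (Fp L) L (IsCMField.complexConj L) (n + n) (hermD L e dV hdV dW hdW) h)) := by
  intro j S h v hv s y u₀ hu₀
  have hk : ∀ w : UnitaryGroup.PlacesOver L v,
      (((u₀ : ↥(unipDeltaLoc L e dV hdV dW hdW v)) : UnitaryGroup.localPi L (IsCMField.complexConj L) (n + n) (hermD L e dV hdV dW hdW) v) :
          UnitaryGroup.LocalGLPi L (n + n) v) w ∈ congruenceGL (n + n) (valuation (w.1.adicCompletion L) (ϖ w.1) ^ (c w.1 + 2 * a h w.1)) :=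
    fun w => coe_apply_mem_congruenceGL_of_mem_kindWLocalBall L e dV hdV dW hdW v u₀ hu₀ w (hϖ w.1) _ (ha₀ h v w)
  have H := FvT_mul_mul_evalPlace_eq L e dV hdV dW hdW FvT ϖ hϖ c hlev j S h ⟨v, hv⟩ s h (fun w => a h w.1) (fun w => ha h w.1)
    (UnitaryGroup.evalPlace (Fp L) L (IsCMField.complexConj L) (n + n) (hermD L e dV hdV dW hdW) v
        (UnitaryGroup.finPart (Fp L) L (IsCMField.complexConj L) (n + n) (hermD L e dV hdV dW hdW) (weylDelta L e dV hdV dW hdW)) *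
      ((y : ↥(unipDeltaLoc L e dV hdV dW hdW v)) : UnitaryGroup.localPi L (IsCMField.complexConj L) (n + n) (hermD L e dV hdV dW hdW) v))
    ((u₀ : ↥(unipDeltaLoc L e dV hdV dW hdW v)) : UnitaryGroup.localPi L (IsCMField.complexConj L) (n + n) (hermD L e dV hdV dW hdW) v) hk
  rw [Subgroup.coe_mul, ← mul_assoc]
  exact H

/-! ## §3 The explicit exponent `a₀ h v := d v + Σ_{w∣v} (c w + 2·a h w)`: the depth letter discharged -/

omit [IsCMField L] in
/-- the depth inequality at the explicit exponent: `|π_v|_w^{d v + Σ_{w′∣v}(c w′ + 2 a h w′)} ≤ |2|_w · |ϖ_w|^{c w + 2 a h w}` (`|π_v|_w^{d v} ≤ |2|_w` by the defect letter; the sum dominates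
its `w`-term and `|π_v|_w ≤ |ϖ_w| ≤ 1`, ★ `valued_toPlace_uniformizer_le`). [cite: PlatonovRapinchuk1994, §5.1] -/
theorem depth_of_sum {π : v.adicCompletion (Fp L)} (hπ : Valued.v π = WithZero.exp (-1 : ℤ))
    (ϖ : (w : HeightOneSpectrum (𝓞 L)) → w.adicCompletion L) (hϖ : ∀ w, Valued.v (ϖ w) = WithZero.exp (-1 : ℤ))
    (cw : UnitaryGroup.PlacesOver L v → ℕ) {d : ℕ} (hd : ∀ w : UnitaryGroup.PlacesOver L v, Valued.v (UnitaryGroup.toPlace v w π) ^ d ≤ Valued.v (2 : w.1.adicCompletion L))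
    (w : UnitaryGroup.PlacesOver L v) :
    Valued.v (UnitaryGroup.toPlace v w π) ^ (((d + ∑ w' : UnitaryGroup.PlacesOver L v, cw w' : ℕ)) : ℤ) ≤
      Valued.v (2 : w.1.adicCompletion L) * Valued.v (ϖ w.1) ^ cw w := by
  classical
  rw [zpow_natCast, pow_add]
  refine mul_le_mul' (hd w) ?_
  have hle : cw w ≤ ∑ w' : UnitaryGroup.PlacesOver L v, cw w' := Finset.single_le_sum (f := cw) (fun _ _ => Nat.zero_le _) (Finset.mem_univ w)
  calc Valued.v (UnitaryGroup.toPlace v w π) ^ (∑ w' : UnitaryGroup.PlacesOver L v, cw w')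
      ≤ Valued.v (UnitaryGroup.toPlace v w π) ^ cw w := pow_le_pow_right_of_le_one' (valued_toPlace_uniformizer_le_one (Fp L) L v hπ w) hle
    _ ≤ Valued.v (ϖ w.1) ^ cw w := by
        refine pow_le_pow_left' ?_ (cw w)
        rw [hϖ w.1]
        exact valued_toPlace_uniformizer_le (Fp L) L v hπ w

set_option maxHeartbeats 800000 in -- MEASURED (as `hFinv_of_levels`): 200 000 and 400 000 fail at `whnf` in the statement, 800 000 passes
/-- **`hFinv` AT THE EXPLICIT EXPONENT `a₀ h v := d v + Σ_{w∣v} (c w + 2·a h w)`** (a natural number, read in `ℤ`): §2 with the depth letter discharged by `depth_of_sum`, given a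
two-defect exponent `d : 𝔭 → ℕ` with `hd : |π_v|_w^{d v} ≤ |2|_w` (§1 `exists_two_defect`).  The (KW-fin-OF-RECORD) package `obtain`s ★ p863728's `hFinv` by name here, with `(Tc, c)`
from ★ `exists_levels_forall_FvT_mul_eq` and `a` from the height letters. [cite: Casselman1980, §3] [cite: HarishChandra1999, §17] [cite: PlatonovRapinchuk1994, §5.1] -/
theorem hFinv_of_levels_sum (T₀ : Finset (HeightOneSpectrum (𝓞 (Fp L))))
    {π : ∀ v : HeightOneSpectrum (𝓞 (Fp L)), v.adicCompletion (Fp L)} (hπ : ∀ v, Valued.v (π v) = WithZero.exp (-1 : ℤ)) {m : ℕ}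
    (FvT : Fin m → ∀ (S : skewMatrices ((IsCMField.complexConj L : L ≃ₐ[Fp L] L) : L →+* L) ((gramR L e dV hdV dW hdW).map (algebraMap (Fp L) L)))
      (h : HA L e dV hdV dW hdW) (v : (kindWFinset L e dV hdV dW hdW T₀ (S : Matrix (Fin n) (Fin n) L) h)),
      ℂ → UnitaryGroup.localPi L (IsCMField.complexConj L) (n + n) (hermD L e dV hdV dW hdW) v.1 → ℂ)
    (ϖ : (w : HeightOneSpectrum (𝓞 L)) → w.adicCompletion L) (hϖ : ∀ w, Valued.v (ϖ w) = WithZero.exp (-1 : ℤ)) (c : HeightOneSpectrum (𝓞 L) → ℕ)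
    (hlev : ∀ (j : Fin m) (S : skewMatrices ((IsCMField.complexConj L : L ≃ₐ[Fp L] L) : L →+* L) ((gramR L e dV hdV dW hdW).map (algebraMap (Fp L) L)))
        (h : HA L e dV hdV dW hdW) (v : (kindWFinset L e dV hdV dW hdW T₀ (S : Matrix (Fin n) (Fin n) L) h)) (s : ℂ)
        (y k : UnitaryGroup.localPi L (IsCMField.complexConj L) (n + n) (hermD L e dV hdV dW hdW) v.1),
        (∀ w : UnitaryGroup.PlacesOver L v.1,
          (k : UnitaryGroup.LocalGLPi L (n + n) v.1) w ∈ congruenceGL (n + n) (valuation (w.1.adicCompletion L) (ϖ w.1) ^ c w.1)) →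
        FvT j S h v s (y * k) = FvT j S h v s y)
    (a : HA L e dV hdV dW hdW → HeightOneSpectrum (𝓞 L) → ℕ)
    (ha : ∀ (x : HA L e dV hdV dW hdW) (w : HeightOneSpectrum (𝓞 L)),
      GLn.localHeight (n + n) L w (UnitaryGroup.adelicVal (Fp L) L (IsCMField.complexConj L) (n + n) (hermD L e dV hdV dW hdW) x) ≤
        ((Ideal.absNorm w.asIdeal : ℕ) : ℝ≥0) ^ a x w)
    (d : HeightOneSpectrum (𝓞 (Fp L)) → ℕ)
    (hd : ∀ (v : HeightOneSpectrum (𝓞 (Fp L))) (w : UnitaryGroup.PlacesOver L v), Valued.v (UnitaryGroup.toPlace v w (π v)) ^ d v ≤ Valued.v (2 : w.1.adicCompletion L)) :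
    ∀ (j : Fin m) (S : skewMatrices ((IsCMField.complexConj L : L ≃ₐ[Fp L] L) : L →+* L) ((gramR L e dV hdV dW hdW).map (algebraMap (Fp L) L)))
      (h : HA L e dV hdV dW hdW) (v : HeightOneSpectrum (𝓞 (Fp L))) (hv : v ∈ kindWFinset L e dV hdV dW hdW T₀ (S : Matrix (Fin n) (Fin n) L) h) (s : ℂ)
      (y u₀ : ↥(unipDeltaLoc L e dV hdV dW hdW v)),
      u₀ ∈ kindWLocalBall L e dV hdV dW hdW v (π v) (((d v + ∑ w : UnitaryGroup.PlacesOver L v, (c w.1 + 2 * a h w.1) : ℕ)) : ℤ) →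
      FvT j S h ⟨v, hv⟩ s (UnitaryGroup.evalPlace (Fp L) L (IsCMField.complexConj L) (n + n) (hermD L e dV hdV dW hdW) v
                (UnitaryGroup.finPart (Fp L) L (IsCMField.complexConj L) (n + n) (hermD L e dV hdV dW hdW) (weylDelta L e dV hdV dW hdW)) *
              ((y * u₀ : ↥(unipDeltaLoc L e dV hdV dW hdW v)) : UnitaryGroup.localPi L (IsCMField.complexConj L) (n + n) (hermD L e dV hdV dW hdW) v) *
              UnitaryGroup.evalPlace (Fp L) L (IsCMField.complexConj L) (n + n) (hermD L e dV hdV dW hdW) v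
                (UnitaryGroup.finPart (Fp L) L (IsCMField.complexConj L) (n + n) (hermD L e dV hdV dW hdW) h)) =
      FvT j S h ⟨v, hv⟩ s (UnitaryGroup.evalPlace (Fp L) L (IsCMField.complexConj L) (n + n) (hermD L e dV hdV dW hdW) v
                (UnitaryGroup.finPart (Fp L) L (IsCMField.complexConj L) (n + n) (hermD L e dV hdV dW hdW) (weylDelta L e dV hdV dW hdW)) *
              ((y : ↥(unipDeltaLoc L e dV hdV dW hdW v)) : UnitaryGroup.localPi L (IsCMField.complexConj L) (n + n) (hermD L e dV hdV dW hdW) v) *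
              UnitaryGroup.evalPlace (Fp L) L (IsCMField.complexConj L) (n + n) (hermD L e dV hdV dW hdW) v
                (UnitaryGroup.finPart (Fp L) L (IsCMField.complexConj L) (n + n) (hermD L e dV hdV dW hdW) h)) :=
  hFinv_of_levels L e dV hdV dW hdW T₀ FvT ϖ hϖ c hlev a ha (fun h v => (((d v + ∑ w : UnitaryGroup.PlacesOver L v, (c w.1 + 2 * a h w.1) : ℕ)) : ℤ))
    fun h v w => depth_of_sum L v (hπ v) ϖ hϖ (fun w => c w.1 + 2 * a h w.1) (hd v) w

end Summit.HodgeConjecture.HodgeConjecture.Cruxes.HLiu418.K2LiuKindWFactorLevelInvarianceBall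

end
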